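import Summits.ResolutionOfSingularities.ResolutionOfSingularities.Theorems.RadicialJungCleanModelsF75cPrincipalizationStep
import Literature.AlgebraicGeometry.Resolution.ExcellentBlowup
import Literature.AlgebraicGeometry.Resolution.RegularBlowup
import Literature.AlgebraicGeometry.Resolution.BlowupReducedDimension
import Literature.AlgebraicGeometry.Resolution.PointCentrePermissible
import Literature.Topology.KrullDimZero
import HarnessLib

/-!
# [F-75c discharge, brick P3] Principalization of an ideal sheaf on a regular surface by blowing up
# closed points (The Stacks Project, Lemma 54.4.1 = Tag 0AHH / Lemma 54.15.5 = Tag 0BIB, via Zariski–Samuel II App. 5)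

Cell res-hironaka, D-0154 INPUTS discharger `res-inputs-p-f75c` for the named fact F-75c
`Literature.AlgebraicGeometry.Resolution.Stacks0BIC_embeddedResolutionCurvesInSurfaces_locus`
(`--supports stmt-ResolutionOfSingularities-15917 --as helper`; consumers `stub_stacks0BICLocus`,
`cleanModels_dimTwo_of_f75c`). HONEST FRAMING: this is the CARTIER STEP of Stacks Lemma 54.15.6 (Tag 0BIC),
i.e. Lemma 54.15.5 (Tag 0BIB) with the centres located (Lemma 54.4.1 = Tag 0AHH: «blowing up of `X_i` at a
closed point lying above a point of `T`»), proved NOT by the cohomological length count of Stacks Lemma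
54.3.5 but by Zariski's finiteness of the base points of an ideal (Zariski–Samuel II, App. 5; tree
`finite_idealBaseTree_of_isRegularLocalRing`, `BaseTreeFiniteKonig.lean`) and the one-step count of brick P2
(`F75c.measure_comap_lt`). Nothing here is a statement of [Hironaka2017]. AI-written; AI review is weaker
than expert review.

## What is proved (namespace `…Theorems.F75c`)

* `finite_nonPrincipalLocus` — on a locally Noetherian, Noetherian-space, regular scheme of dimension `≤ 2`
  the non-locally-principal locus of an ideal sheaf is a finite set of closed points with two-dimensional
  local rings (regular local rings of dimension `≤ 1` are principal ideal rings; `height + coheight ≤ 2`).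
* `IsPointBlowupComposition.invariants` — Noetherian, regular, excellent, dimension `≤ 2` persist along a
  composition of point blow-ups (tree: `IsBlowup.isRegular_of_isRegular_subscheme`, `IsBlowup.isExcellent`,
  `IsBlowup.topologicalKrullDim_le_of_isLocallyNoetherian`).
* **`exists_isPointBlowupComposition_isLocallyPrincipal`** — for an INTEGRAL Noetherian regular scheme `X`
  of dimension `≤ 2` and an ideal sheaf `I`, there is a composition `π : X' → X` of blowing ups at closed
  points, all lying over the non-locally-principal locus of `I` (`⊆ V(I)`), with `I·𝒪_{X'}` locally
  principal (Stacks Tag 0AHH for integral `X`; induction on the measure of brick P2).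

References: The Stacks Project, Tags 0AHH, 0BIB [StacksProject]; Zariski–Samuel II (1960), App. 5 [ZariskiSamuel1960].
-/

noncomputable section

set_option linter.dupNamespace false -- mandated namespace of this single-conjunct summit

open CategoryTheory AlgebraicGeometry TopologicalSpace IsLocalRing

namespace Summit.ResolutionOfSingularities.ResolutionOfSingularities.Theorems

namespace F75c

open Literature.AlgebraicGeometry.Resolution
open Summit.ResolutionOfSingularities.ResolutionOfSingularities.Theorems.CampaignW46
open Scheme.IdealSheafData

universe u

/-! ## The non-locally-principal locus on a regular surface -/

/-- **On a regular scheme of dimension `≤ 2` the non-locally-principal locus of an ideal sheaf is a finite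
set of closed points with two-dimensional local rings.** [cite: StacksProject, Tag 0AHH]
[cite: CossartPiltant2008, proof of Prop. 4.2] -/
theorem finite_nonPrincipalLocus {X : Scheme.{u}} [IsLocallyNoetherian X] [NoetherianSpace X]
    (hreg : Scheme.IsRegular X) (hdim : topologicalKrullDim X ≤ 2) (J : X.IdealSheafData) :
    (nonPrincipalLocus J : Set X).Finite ∧
      ∀ x ∈ nonPrincipalLocus J, IsClosed ({x} : Set X) ∧ ringKrullDim (X.presheaf.stalk x) = 2 := by
  -- at a point of the locus: `coheight = 2`, `height = 0`
  have key : ∀ x ∈ nonPrincipalLocus J, Order.height x = 0 ∧ Order.coheight x = 2 := by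
    intro x hx
    have h1 : (1 : ℕ∞) < Order.coheight x := one_lt_coheight_of_mem_nonPrincipalLocus hreg hx
    have h2 : Order.height x + Order.coheight x ≤ 2 := by
      have := (coe_height_add_coheight_le_topologicalKrullDim x).trans hdim
      rwa [← WithBot.coe_ofNat, WithBot.coe_le_coe] at this
    have hc : Order.coheight x ≠ ⊤ := by
      intro h
      rw [h, add_top, top_le_iff] at h2
      exact ENat.coe_ne_top 2 h2
    have hh : Order.height x ≠ ⊤ := by
      intro h
      rw [h, top_add, top_le_iff] at h2
      exact ENat.coe_ne_top 2 h2
    obtain ⟨c, hc'⟩ := ENat.ne_top_iff_exists.mp hc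
    obtain ⟨a, ha'⟩ := ENat.ne_top_iff_exists.mp hh
    rw [← hc', ← ha'] at h2
    rw [← hc'] at h1
    rw [← ha', ← hc']
    have h1' : 1 < c := by exact_mod_cast h1
    have h2' : a + c ≤ 2 := by exact_mod_cast h2
    exact ⟨by exact_mod_cast (show a = 0 by omega), by exact_mod_cast (show c = 2 by omega)⟩
  have h0 : topologicalKrullDim (nonPrincipalLocus J : Set X) ≤ 0 := by
    have := topologicalKrullDim_le_of_forall_height_le (nonPrincipalLocus J).isClosed 0
      fun x hx => ((key x hx).1).le
    exact_mod_cast this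
  refine ⟨Set.finite_of_topologicalKrullDim_le_zero h0, fun x hx => ⟨?_, ?_⟩⟩
  · exact Literature.Topology.Set.isClosed_singleton_of_topologicalKrullDim_le_zero
      (nonPrincipalLocus J).isClosed h0 hx
  · rw [ringKrullDim_stalk_eq_coheight x, (key x hx).2]
    rfl

/-! ## Invariants along compositions of point blow-ups -/

/-- **Noetherian, regular, excellent and `dim ≤ 2` persist along a composition of blowing ups at closed
points.** [cite: StacksProject, Tag 0BIC (Lemma 54.15.6, proof ¶1)] [cite: Liu2002, Thm. 8.1.19]
[cite: Matsumura1987, §32 p. 260] -/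
theorem IsPointBlowupComposition.invariants {X : Scheme.{u}} [IsNoetherian X] {T : Set X} :
    ∀ {X' : Scheme.{u}} {π : X' ⟶ X}, IsPointBlowupComposition T π →
      Scheme.IsRegular X → Scheme.IsExcellent X → topologicalKrullDim X ≤ 2 →
      IsNoetherian X' ∧ Scheme.IsRegular X' ∧ Scheme.IsExcellent X' ∧ topologicalKrullDim X' ≤ 2 := by
  intro X' π h
  induction h with
  | nil => exact fun hr he hd => ⟨inferInstance, hr, he, hd⟩
  | cons τ σ x' hx' hσ hne hT hτ ih =>
    intro hr he hd
    obtain ⟨hN, hr', he', hd'⟩ := ih hr he hd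
    haveI := hN
    haveI : IsProper τ := hτ.isProper
    haveI : IsLocallyNoetherian _ := LocallyOfFiniteType.isLocallyNoetherian τ
    haveI : CompactSpace _ := QuasiCompact.compactSpace_of_compactSpace τ
    refine ⟨{}, ?_, hτ.isExcellent he', ?_⟩
    · exact hτ.isRegular_of_isRegular_subscheme hr' (isRegular_subscheme_vanishingIdeal_singleton hx')
    · have h2 : topologicalKrullDim _ ≤ ((2 : ℕ) : WithBot ℕ∞) :=
        hτ.topologicalKrullDim_le_of_isLocallyNoetherian (n := 2) (by exact_mod_cast hd')
      exact_mod_cast h2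

/-! ## Principalization by point blow-ups (Stacks Tag 0AHH, integral case) -/

/-- **Principalization of an ideal sheaf on an integral regular surface by blowing up closed points**
(The Stacks Project, Lemma 54.4.1 = Tag 0AHH and Lemma 54.15.5 = Tag 0BIB, integral case, located form):
for `X` integral, Noetherian, regular, excellent of dimension `≤ 2` and an ideal sheaf `I` there are a
composition `π : X' → X` of blowing ups at closed points, each lying over the non-locally-principal locus of
`I`, such that `I·𝒪_{X'}` is locally principal. Proof: induction on `Σ_{x ∈ NP(I)} #idealBaseTree R_x J_x`
(finite by Zariski–Samuel II App. 5), which drops under the blowing up of a point of `NP(I)` (brick P2).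
[cite: StacksProject, Tag 0AHH (Lemma 54.4.1)] [cite: StacksProject, Tag 0BIB (Lemma 54.15.5)]
[cite: ZariskiSamuel1960, Appendix 5] -/
theorem exists_isPointBlowupComposition_isLocallyPrincipal (X : Scheme.{u}) [IsIntegral X] [IsNoetherian X]
    (hreg : Scheme.IsRegular X) (hexc : Scheme.IsExcellent X) (hdim : topologicalKrullDim X ≤ 2)
    (I : X.IdealSheafData) :
    ∃ (X' : Scheme.{u}) (π : X' ⟶ X), IsPointBlowupComposition (nonPrincipalLocus I : Set X) π ∧
      IsLocallyPrincipal (I.comap π) := by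
  classical
  -- the measure
  let N : ∀ (Y : Scheme.{u}) [IsIntegral Y] (J : Y.IdealSheafData),
      (nonPrincipalLocus J : Set Y).Finite → ℕ :=
    fun Y _ J hN => ∑ y ∈ hN.toFinset, (idealBaseTree (algebraMap (Y.presheaf.stalk y) Y.functionField).range
      ((stalkIdeal J y).map (algebraMap (Y.presheaf.stalk y) Y.functionField).rangeRestrict)).ncard
  suffices H : ∀ (n : ℕ) (Y : Scheme.{u}) [IsIntegral Y] [IsNoetherian Y], Scheme.IsRegular Y →
      Scheme.IsExcellent Y → topologicalKrullDim Y ≤ 2 → ∀ (J : Y.IdealSheafData)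
      (hN : (nonPrincipalLocus J : Set Y).Finite), N Y J hN ≤ n →
      ∃ (Y' : Scheme.{u}) (π : Y' ⟶ Y), IsPointBlowupComposition (nonPrincipalLocus J : Set Y) π ∧
        IsLocallyPrincipal (J.comap π) from
    H _ X hreg hexc hdim I (finite_nonPrincipalLocus hreg hdim I).1 le_rfl
  intro n
  induction n with
  | zero =>
    intro Y _ _ hreg hexc hdim J hN hle
    -- measure `0`: every local count is `≥ 1` on the locus, so the locus is empty
    have hempty : (nonPrincipalLocus J : Set Y) = ∅ := by
      by_contra hne
      obtain ⟨y, hy⟩ := Set.nonempty_iff_ne_empty.mpr hne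
      have hy2 := ((finite_nonPrincipalLocus hreg hdim J).2 y hy).2
      haveI := hreg y
      haveI := isLocalRing_range_algebraMap_stalk (Z := Y) y
      haveI : IsRegularLocalRing (algebraMap (Y.presheaf.stalk y) Y.functionField).range :=
        isRegularLocalRing_range_of y
      have hR2 : ringKrullDim (algebraMap (Y.presheaf.stalk y) Y.functionField).range = 2 := by
        rw [ringKrullDim_range_algebraMap_stalk]; exact hy2
      have hyJ : ¬ (stalkIdeal J y).IsPrincipal := by
        have h := hy
        rw [coe_nonPrincipalLocus_eq_setOf_not_isPrincipal] at h
        exact h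
      have h1 := one_le_ncard_idealBaseTree
        (fun h => hyJ ((isPrincipal_stalkIdeal_iff J y).mp h))
        (finite_idealBaseTree_of_isRegularLocalRing _ hR2 (isLocalRingOf_range_algebraMap_stalk y) _)
      have hyN : y ∈ hN.toFinset := by rw [Set.Finite.mem_toFinset]; exact hy
      have := Finset.single_le_sum (f := fun z => (idealBaseTree (algebraMap (Y.presheaf.stalk z) Y.functionField).range
        ((stalkIdeal J z).map (algebraMap (Y.presheaf.stalk z) Y.functionField).rangeRestrict)).ncard)
        (fun z _ => Nat.zero_le _) hyN
      change _ ≤ N Y J hN at this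
      omega
    refine ⟨Y, 𝟙 Y, IsPointBlowupComposition.nil, ?_⟩
    rw [Scheme.IdealSheafData.comap_id]
    exact (nonPrincipalLocus_eq_bot_iff J).mp (by
      apply Closeds.ext; rw [hempty]; rfl)
  | succ n ih =>
    intro Y _ _ hreg hexc hdim J hN hle
    by_cases hempty : (nonPrincipalLocus J : Set Y) = ∅
    · refine ⟨Y, 𝟙 Y, IsPointBlowupComposition.nil, ?_⟩
      rw [Scheme.IdealSheafData.comap_id]
      exact (nonPrincipalLocus_eq_bot_iff J).mp (by
        apply Closeds.ext; rw [hempty]; rfl)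
    -- a non-principal point `y`: closed, with two-dimensional regular local ring
    obtain ⟨y, hy⟩ := Set.nonempty_iff_ne_empty.mpr hempty
    obtain ⟨hyc, hy2⟩ := (finite_nonPrincipalLocus hreg hdim J).2 y hy
    haveI := hreg y
    have hyne : ({y} : Set Y) ≠ Set.univ := by
      intro h
      have hJ0 : J ≠ ⊥ := by
        rintro rfl
        have h' := hy
        rw [coe_nonPrincipalLocus_eq_setOf_not_isPrincipal, Set.mem_setOf_eq] at h'
        apply h'
        rw [stalkIdeal_bot]
        exact ⟨⟨0, by simp⟩⟩
      have hη : genericPoint Y ∈ ({y} : Set Y) := h ▸ Set.mem_univ _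
      rw [Set.mem_singleton_iff] at hη
      exact genericPoint_not_mem_nonPrincipalLocus hJ0 (hη ▸ hy)
    -- blow up `y`
    obtain ⟨Y₁, π₁, hπ₁⟩ := exists_isBlowup Y (vanishingIdeal ⟨{y}, hyc⟩)
    haveI : IsIntegral Y₁ := hπ₁.isIntegral (vanishingIdeal_singleton_ne_bot hyc hyne)
    have h₁ : IsPointBlowupComposition (nonPrincipalLocus J : Set Y) π₁ :=
      IsPointBlowupComposition.single π₁ y hyc hyne hy hπ₁
    obtain ⟨hN₁, hreg₁, hexc₁, hdim₁⟩ := IsPointBlowupComposition.invariants h₁ hreg hexc hdim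
    haveI := hN₁
    have hfin₁ := (finite_nonPrincipalLocus hreg₁ hdim₁ (J.comap π₁)).1
    -- the measure drops
    have hlt : N Y₁ (J.comap π₁) hfin₁ < N Y J hN := measure_comap_lt hyc hπ₁ hy2 J hy hN hfin₁
    obtain ⟨Y', π', hπ', hlp⟩ := ih Y₁ hreg₁ hexc₁ hdim₁ (J.comap π₁) hfin₁ (by omega)
    refine ⟨Y', π' ≫ π₁, h₁.comp ?_ hπ', by rwa [Scheme.IdealSheafData.comap_comp]⟩
    rintro _ ⟨y', hy', rfl⟩
    exact nonPrincipalLocus_comap_subset π₁ J hy'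

end F75c

end Summit.ResolutionOfSingularities.ResolutionOfSingularities.Theorems

end
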